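import Literature.MathematicalPhysics.QuantumLattice.DWaveSourceEnergyDensityEnsembles
import HarnessLib

/-!
# Readers: certified pair-sourced torus energy rows along divisible sides, into the torus-limit energy
# density `e_src`, the Legendre object `gcEnergyDensityTT'`, and canonical tangent floors

Topic `Literature/MathematicalPhysics/QuantumLattice` (family `hubbard`); sequel of
`DWaveSourceEnergyDensityEnsembles.lean`. The certified ENERGY ROWS of the pinning-field menus of the
Hubbard cuprate cell have the shape "for every torus side `L ≥ L₀` with `q ∣ L`,
`lo·L² ≤ E₀(A_L(t',U,μ,h))`" (resp. `E₀(A_L) ≤ hi·L²`), `A_L = dWaveSourceTorusTT' L t' U μ h`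
(a translation-invariant window certificate holds on every torus into which its window fits, `q = 1`;
trial states tiling the torus by `q × q` blocks give `q ∣ L`). This file reads such rows — and the two
other certified shapes in use, rows along a prescribed divergent side sequence and lower bounds valid for
every translation-invariant infinite-volume state — into the three identified thermodynamic-limit objects:

* §1 `E₀(A_{L_j})/L_j² → e_src` along EVERY divergent side sequence
  (`tendsto_groundEnergy_dWaveSourceTorusTT'_div_sq_along`); rows along such a sequence, or along the
  divisible sides, bound `e_src = dWaveSourceEnergyDensityTT' t' U μ h` (`…_ge_of_forall_dvd_le`,
  `…_le_of_forall_dvd_le`, `…_along`).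
* §2 at `h = 0`, `U ≥ 0`: the same rows, and every-translation-invariant-state floors, bound the Legendre
  object `gcEnergyDensityTT' 1 t' U μ` (the premise `c ≤ gcEnergyDensityTT' 1 t' U μ` of the grand-canonical
  response-floor consumers); literal `t' = 0` forms on `dWaveSourceTorus L U μ 0`; conversely an
  all-density canonical tangent `c + μm ≤ e(1,t',U,m)` is a floor on `e_src(t',U,μ,0)`.
* §3 the canonical TANGENT floors `lo + μn ≤ energyDensityTT' 1 t' U n` (every density `n ∈ [0,2)`) from a
  grand-canonical row at `h = 0` along divisible sides; literal `t' = 0` form.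

Everything is PROVED; no definition, no named fact. HONEST SCOPE: plumbing only (Ruelle's equivalence of
ensembles read for certified finite-torus data); nothing here bears on whether the Hubbard model orders.

## References
* D. Ruelle, *Statistical Mechanics: Rigorous Results* (1969), §3.3–§3.4 (thermodynamic limit along
  sequences of boxes; equivalence of ensembles). [cite: Ruelle1969, §3.4]
* O. Bratteli, A. Kishimoto, D. W. Robinson, Commun. Math. Phys. 64 (1978) 41, Thm. 2.
  [cite: BratteliKishimotoRobinson1978, Thm. 2]
* T. Koma, H. Tasaki, J. Stat. Phys. 76 (1994) 745, §1. [cite: KomaTasaki1994, §1]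
-/

noncomputable section

namespace Literature.MathematicalPhysics.QuantumLattice

open _root_.Matrix Finset HubbardWave0 Literature.Probability.LatticeModels _root_.Filter ThermodynamicLimit
open scoped _root_.Topology ComplexOrder BigOperators

/-! ### §1 Rows along divergent side sequences and along divisible sides -/

section Along

variable (t' U μ h : ℝ)

/-- **The energies per site converge to `e_src` along EVERY divergent sequence of (non-zero) sides**:
`E₀(A_{L_j}(t',U,μ,h))/L_j² → e_src(t',U,μ,h)` whenever `L_j → ∞` (the defining limit is along `L + 1`;
reindex). [cite: Ruelle1969, §3.4] -/
theorem tendsto_groundEnergy_dWaveSourceTorusTT'_div_sq_along {Ls : ℕ → ℕ} [hL0 : ∀ j, NeZero (Ls j)]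
    (hLs : Tendsto Ls atTop atTop) :
    Tendsto (fun j => (dWaveSourceTorusTT' (Ls j) t' U μ h).groundEnergy / ((Ls j : ℝ)) ^ 2) atTop
      (𝓝 (dWaveSourceEnergyDensityTT' t' U μ h)) := by
  set G : ℕ → ℝ := fun K =>
    (dWaveSourceTorusTT' (K + 1) t' U μ h).groundEnergy / (((K + 1 : ℕ) : ℝ)) ^ 2 with hG
  have key : ∀ (n : ℕ) [NeZero n],
      G (n - 1) = (dWaveSourceTorusTT' n t' U μ h).groundEnergy / ((n : ℝ)) ^ 2 := by
    intro n hn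
    obtain ⟨K, rfl⟩ := Nat.exists_eq_succ_of_ne_zero hn.out
    simp only [hG, Nat.succ_sub_one]
  have h1 := (tendsto_dWaveSourceEnergyDensityTT' t' U μ h).comp ((tendsto_sub_atTop_nat 1).comp hLs)
  refine h1.congr fun j => ?_
  simp only [Function.comp_def]
  exact key (Ls j)

/-- **A floor along a divergent side sequence passes to `e_src`**: if `lo·L_j² ≤ E₀(A_{L_j})` for all
large `j`, then `lo ≤ e_src(t',U,μ,h)`. [cite: Ruelle1969, §3.4] -/
theorem dWaveSourceEnergyDensityTT'_ge_of_eventually_le_along {Ls : ℕ → ℕ} [hL0 : ∀ j, NeZero (Ls j)]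
    (hLs : Tendsto Ls atTop atTop) {lo : ℝ}
    (hlo : ∀ᶠ j in atTop, lo * ((Ls j : ℝ)) ^ 2 ≤ (dWaveSourceTorusTT' (Ls j) t' U μ h).groundEnergy) :
    lo ≤ dWaveSourceEnergyDensityTT' t' U μ h := by
  refine ge_of_tendsto (tendsto_groundEnergy_dWaveSourceTorusTT'_div_sq_along t' U μ h hLs) ?_
  filter_upwards [hlo] with j hj
  have hpos : (0 : ℝ) < ((Ls j : ℝ)) ^ 2 := by
    have : (0 : ℝ) < (Ls j : ℝ) := Nat.cast_pos.2 (Nat.pos_of_ne_zero (hL0 j).out)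
    positivity
  rwa [le_div_iff₀ hpos]

/-- **A ceiling along a divergent side sequence passes to `e_src`**: if `E₀(A_{L_j}) ≤ hi·L_j²` for all
large `j`, then `e_src(t',U,μ,h) ≤ hi`. [cite: Ruelle1969, §3.4] -/
theorem dWaveSourceEnergyDensityTT'_le_of_eventually_le_along {Ls : ℕ → ℕ} [hL0 : ∀ j, NeZero (Ls j)]
    (hLs : Tendsto Ls atTop atTop) {hi : ℝ}
    (hhi : ∀ᶠ j in atTop, (dWaveSourceTorusTT' (Ls j) t' U μ h).groundEnergy ≤ hi * ((Ls j : ℝ)) ^ 2) :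
    dWaveSourceEnergyDensityTT' t' U μ h ≤ hi := by
  refine le_of_tendsto (tendsto_groundEnergy_dWaveSourceTorusTT'_div_sq_along t' U μ h hLs) ?_
  filter_upwards [hhi] with j hj
  have hpos : (0 : ℝ) < ((Ls j : ℝ)) ^ 2 := by
    have : (0 : ℝ) < (Ls j : ℝ) := Nat.cast_pos.2 (Nat.pos_of_ne_zero (hL0 j).out)
    positivity
  rwa [div_le_iff₀ hpos]

/-- The divisible sides `q, 2q, 3q, …` (`q ≥ 1`) diverge. [folklore] -/
private theorem tendsto_mul_succ_atTop {q : ℕ} (hq : 0 < q) :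
    Tendsto (fun j : ℕ => q * (j + 1)) atTop atTop :=
  (tendsto_add_atTop_nat 1).const_mul_atTop' hq

/-- **A floor on the divisible sides passes to `e_src`** (the menu row shape): if `lo·L² ≤ E₀(A_L(t',U,μ,h))`
for every side `L ≥ L₀` with `q ∣ L` (`q ≥ 1`), then `lo ≤ e_src(t',U,μ,h)`. [cite: Ruelle1969, §3.4] -/
theorem dWaveSourceEnergyDensityTT'_ge_of_forall_dvd_le {lo : ℝ} {q L₀ : ℕ} (hq : 0 < q)
    (hlo : ∀ (L : ℕ) [NeZero L], L₀ ≤ L → q ∣ L →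
      lo * (L : ℝ) ^ 2 ≤ (dWaveSourceTorusTT' L t' U μ h).groundEnergy) :
    lo ≤ dWaveSourceEnergyDensityTT' t' U μ h := by
  haveI hL0 : ∀ j : ℕ, NeZero (q * (j + 1)) := fun j => ⟨Nat.mul_ne_zero hq.ne' (Nat.succ_ne_zero j)⟩
  refine dWaveSourceEnergyDensityTT'_ge_of_eventually_le_along t' U μ h (Ls := fun j => q * (j + 1))
    (tendsto_mul_succ_atTop hq) ?_
  filter_upwards [(tendsto_mul_succ_atTop hq).eventually_ge_atTop L₀] with j hj
  exact hlo (q * (j + 1)) hj (Dvd.intro _ rfl)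

/-- **A ceiling on the divisible sides passes to `e_src`**: if `E₀(A_L(t',U,μ,h)) ≤ hi·L²` for every side
`L ≥ L₀` with `q ∣ L` (`q ≥ 1`; e.g. Rayleigh quotients of states tiling the torus by `q × q` blocks), then
`e_src(t',U,μ,h) ≤ hi`. [cite: Ruelle1969, §3.4] -/
theorem dWaveSourceEnergyDensityTT'_le_of_forall_dvd_le {hi : ℝ} {q L₀ : ℕ} (hq : 0 < q)
    (hhi : ∀ (L : ℕ) [NeZero L], L₀ ≤ L → q ∣ L →
      (dWaveSourceTorusTT' L t' U μ h).groundEnergy ≤ hi * (L : ℝ) ^ 2) :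
    dWaveSourceEnergyDensityTT' t' U μ h ≤ hi := by
  haveI hL0 : ∀ j : ℕ, NeZero (q * (j + 1)) := fun j => ⟨Nat.mul_ne_zero hq.ne' (Nat.succ_ne_zero j)⟩
  refine dWaveSourceEnergyDensityTT'_le_of_eventually_le_along t' U μ h (Ls := fun j => q * (j + 1))
    (tendsto_mul_succ_atTop hq) ?_
  filter_upwards [(tendsto_mul_succ_atTop hq).eventually_ge_atTop L₀] with j hj
  exact hhi (q * (j + 1)) hj (Dvd.intro _ rfl)

/-- `t' = 0` literal floor form, on the tree's `dWaveSourceTorus L U μ h`. [cite: Ruelle1969, §3.4] -/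
theorem dWaveSourceEnergyDensity_ge_of_forall_dvd_le (U μ h : ℝ) {lo : ℝ} {q L₀ : ℕ} (hq : 0 < q)
    (hlo : ∀ (L : ℕ) [NeZero L], L₀ ≤ L → q ∣ L →
      lo * (L : ℝ) ^ 2 ≤ (dWaveSourceTorus L U μ h).groundEnergy) :
    lo ≤ dWaveSourceEnergyDensity U μ h := by
  rw [← dWaveSourceEnergyDensityTT'_zero_tp]
  refine dWaveSourceEnergyDensityTT'_ge_of_forall_dvd_le 0 U μ h (L₀ := L₀) hq fun L _ hL hqL => ?_
  rw [dWaveSourceTorusTT'_zero_tp]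
  exact hlo L hL hqL

/-- `t' = 0` literal ceiling form. [cite: Ruelle1969, §3.4] -/
theorem dWaveSourceEnergyDensity_le_of_forall_dvd_le (U μ h : ℝ) {hi : ℝ} {q L₀ : ℕ} (hq : 0 < q)
    (hhi : ∀ (L : ℕ) [NeZero L], L₀ ≤ L → q ∣ L →
      (dWaveSourceTorus L U μ h).groundEnergy ≤ hi * (L : ℝ) ^ 2) :
    dWaveSourceEnergyDensity U μ h ≤ hi := by
  rw [← dWaveSourceEnergyDensityTT'_zero_tp]
  refine dWaveSourceEnergyDensityTT'_le_of_forall_dvd_le 0 U μ h (L₀ := L₀) hq fun L _ hL hqL => ?_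
  rw [dWaveSourceTorusTT'_zero_tp]
  exact hhi L hL hqL

end Along

/-! ### §2 Readers into the Legendre object `gcEnergyDensityTT'` (`h = 0`, `U ≥ 0`) -/

section Legendre

/-- **A grand-canonical torus FLOOR at `h = 0` along the divisible sides is a floor on the Legendre
object**: `lo·L² ≤ E₀(H_L(1,t',U) − μN_L)` for every `L ≥ L₀` with `q ∣ L` gives
`lo ≤ gcEnergyDensityTT' 1 t' U μ` (`U ≥ 0`) — the premise of the grand-canonical response-floor consumers.
[cite: Ruelle1969, §3.4] -/
theorem le_gcEnergyDensityTT'_of_forall_dvd_groundEnergy_ge (t' : ℝ) {U : ℝ} (hU : 0 ≤ U) (μ : ℝ)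
    {lo : ℝ} {q L₀ : ℕ} (hq : 0 < q)
    (hlo : ∀ (L : ℕ) [NeZero L], L₀ ≤ L → q ∣ L →
      lo * (L : ℝ) ^ 2 ≤ (dWaveSourceTorusTT' L t' U μ 0).groundEnergy) :
    lo ≤ gcEnergyDensityTT' 1 t' U μ := by
  rw [← dWaveSourceEnergyDensityTT'_zero_eq_gcEnergyDensityTT' t' hU μ]
  exact dWaveSourceEnergyDensityTT'_ge_of_forall_dvd_le t' U μ 0 hq hlo

/-- **`t' = 0` literal form** (the source-free legs `G_μ` of a sourced menu, on `dWaveSourceTorus L U μ 0 =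
H_L(1,U) − μN_L`): `lo ≤ gcEnergyDensityTT' 1 0 U μ`. [cite: Ruelle1969, §3.4] -/
theorem le_gcEnergyDensityTT'_of_forall_dvd_groundEnergy_dWaveSourceTorus_ge {U : ℝ} (hU : 0 ≤ U) (μ : ℝ)
    {lo : ℝ} {q L₀ : ℕ} (hq : 0 < q)
    (hlo : ∀ (L : ℕ) [NeZero L], L₀ ≤ L → q ∣ L →
      lo * (L : ℝ) ^ 2 ≤ (dWaveSourceTorus L U μ 0).groundEnergy) :
    lo ≤ gcEnergyDensityTT' 1 0 U μ := by
  rw [← dWaveSourceEnergyDensity_zero_eq_gcEnergyDensityTT' hU μ]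
  exact dWaveSourceEnergyDensity_ge_of_forall_dvd_le U μ 0 hq hlo

/-- **A floor along any divergent side sequence at `h = 0` is a floor on the Legendre object.**
[cite: Ruelle1969, §3.4] -/
theorem le_gcEnergyDensityTT'_of_eventually_groundEnergy_ge_along (t' : ℝ) {U : ℝ} (hU : 0 ≤ U) (μ : ℝ)
    {Ls : ℕ → ℕ} [hL0 : ∀ j, NeZero (Ls j)] (hLs : Tendsto Ls atTop atTop) {lo : ℝ}
    (hlo : ∀ᶠ j in atTop, lo * ((Ls j : ℝ)) ^ 2 ≤ (dWaveSourceTorusTT' (Ls j) t' U μ 0).groundEnergy) :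
    lo ≤ gcEnergyDensityTT' 1 t' U μ := by
  rw [← dWaveSourceEnergyDensityTT'_zero_eq_gcEnergyDensityTT' t' hU μ]
  exact dWaveSourceEnergyDensityTT'_ge_of_eventually_le_along t' U μ 0 hLs hlo

/-- **An every-translation-invariant-state FLOOR is a floor on the Legendre object** (the output shape of
an infinite-volume relaxation certificate with the chemical-potential term in the objective): if
`lo ≤ e^{tt'}(ω) − μρ(ω)` for every translation-invariant `ω`, then `lo ≤ gcEnergyDensityTT' t t' U μ`
(every `t`; `U ≥ 0`). [cite: BratteliKishimotoRobinson1978, Thm. 2] -/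
theorem le_gcEnergyDensityTT'_of_forall_isTranslationInvariant_le_meanEnergy (t t' : ℝ) {U : ℝ}
    (hU : 0 ≤ U) (μ : ℝ) {lo : ℝ}
    (hlo : ∀ ω : InfVolFermionState 2, ω.IsTranslationInvariant →
      lo ≤ ω.meanEnergy (hubbardTTPrimeMuInteraction t t' U μ) 1) :
    lo ≤ gcEnergyDensityTT' t t' U μ := by
  rw [← tiGroundEnergyDensity_hubbardTTPrimeMu_eq_gcEnergyDensityTT' t t' hU μ]
  exact FermionInteraction.le_tiGroundEnergyDensity _ _ hlo

/-- **A CEILING on the Legendre object from one torus-tiling family**: `E₀(H_L(1,t',U) − μN_L) ≤ hi·L²`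
for every `L ≥ L₀` with `q ∣ L` gives `gcEnergyDensityTT' 1 t' U μ ≤ hi` (`U ≥ 0`).
[cite: Ruelle1969, §3.4] -/
theorem gcEnergyDensityTT'_le_of_forall_dvd_groundEnergy_le (t' : ℝ) {U : ℝ} (hU : 0 ≤ U) (μ : ℝ)
    {hi : ℝ} {q L₀ : ℕ} (hq : 0 < q)
    (hhi : ∀ (L : ℕ) [NeZero L], L₀ ≤ L → q ∣ L →
      (dWaveSourceTorusTT' L t' U μ 0).groundEnergy ≤ hi * (L : ℝ) ^ 2) :
    gcEnergyDensityTT' 1 t' U μ ≤ hi := by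
  rw [← dWaveSourceEnergyDensityTT'_zero_eq_gcEnergyDensityTT' t' hU μ]
  exact dWaveSourceEnergyDensityTT'_le_of_forall_dvd_le t' U μ 0 hq hhi

/-- **Conversely, an all-density canonical TANGENT is a floor on the torus-limit object at `h = 0`**: if
`c + μm ≤ energyDensityTT' 1 t' U m` for every `m ∈ [0, 2)` (e.g. a canonical certificate whose dual bound
is affine in the density right-hand side, read uniformly in the density), then `c ≤ e_src(t',U,μ,0)`
(`U ≥ 0`). [cite: Ruelle1969, §3.4] -/
theorem le_dWaveSourceEnergyDensityTT'_zero_of_forall_tangent (t' : ℝ) {U : ℝ} (hU : 0 ≤ U) {c μ : ℝ}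
    (hc : ∀ m : ℝ, 0 ≤ m → m < 2 → c + μ * m ≤ energyDensityTT' 1 t' U m) :
    c ≤ dWaveSourceEnergyDensityTT' t' U μ 0 := by
  rw [dWaveSourceEnergyDensityTT'_zero_eq_gcEnergyDensityTT' t' hU μ]
  exact le_gcEnergyDensityTT' hc

/-- Interior form: the tangent only needs to be certified at the interior densities `0 < m < 2`.
[cite: Ruelle1969, §3.4] -/
theorem le_dWaveSourceEnergyDensityTT'_zero_of_forall_tangent_Ioo (t' : ℝ) {U : ℝ} (hU : 0 ≤ U) {c μ : ℝ}
    (hc : ∀ m : ℝ, 0 < m → m < 2 → c + μ * m ≤ energyDensityTT' 1 t' U m) :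
    c ≤ dWaveSourceEnergyDensityTT' t' U μ 0 := by
  rw [dWaveSourceEnergyDensityTT'_zero_eq_gcEnergyDensityTT' t' hU μ]
  exact le_gcEnergyDensityTT'_of_Ioo 1 t' hU hc

/-- Hence such a tangent is a floor on the energies per site of EVERY large pair-sourced torus at `h = 0`?
No — only on their LIMIT; but it IS a floor on the sourced mean energy of every translation-invariant state
at `h = 0`: `c ≤ e^{1,t',U}(ω) − μρ(ω)` for all translation-invariant `ω`. [cite: BratteliKishimotoRobinson1978, Thm. 2] -/
theorem le_meanEnergy_hubbardTTPrimeMu_of_forall_tangent (t' : ℝ) {U : ℝ} (hU : 0 ≤ U) {c μ : ℝ}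
    (hc : ∀ m : ℝ, 0 ≤ m → m < 2 → c + μ * m ≤ energyDensityTT' 1 t' U m)
    {ω : InfVolFermionState 2} (hω : ω.IsTranslationInvariant) :
    c ≤ ω.meanEnergy (hubbardTTPrimeMuInteraction 1 t' U μ) 1 :=
  (le_gcEnergyDensityTT' hc).trans (gcEnergyDensityTT'_le_meanEnergy_hubbardTTPrimeMu 1 t' hU μ hω)

end Legendre

/-! ### §3 Canonical tangent floors from grand-canonical rows at `h = 0` -/

section Tangent

/-- **A grand-canonical torus FLOOR at `h = 0` on the divisible sides is a canonical TANGENT floor at every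
density**: `lo·L² ≤ E₀(H_L(1,t',U) − μN_L)` for every `L ≥ L₀` with `q ∣ L` gives
`lo + μn ≤ energyDensityTT' 1 t' U n` for every `n ∈ [0, 2)` (`U ≥ 0`). [cite: Ruelle1969, §3.4] -/
theorem add_mul_le_energyDensityTT'_of_forall_dvd_groundEnergy_ge (t' : ℝ) {U : ℝ} (hU : 0 ≤ U) (μ : ℝ)
    {lo : ℝ} {q L₀ : ℕ} (hq : 0 < q)
    (hlo : ∀ (L : ℕ) [NeZero L], L₀ ≤ L → q ∣ L →
      lo * (L : ℝ) ^ 2 ≤ (dWaveSourceTorusTT' L t' U μ 0).groundEnergy)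
    {n : ℝ} (hn0 : 0 ≤ n) (hn2 : n < 2) :
    lo + μ * n ≤ energyDensityTT' 1 t' U n := by
  have h := dWaveSourceEnergyDensityTT'_ge_of_forall_dvd_le t' U μ 0 hq hlo
  linarith [dWaveSourceEnergyDensityTT'_zero_add_mul_le_energyDensityTT' t' hU μ hn0 hn2]

/-- **`t' = 0` literal form**: rows on `dWaveSourceTorus L U μ 0` give `lo + μn ≤ energyDensityTT' 1 0 U n`
for every `n ∈ [0, 2)` — at `(U, n) = (8, 7/8)` a number of the same class as the canonical anchor rows.
[cite: Ruelle1969, §3.4] -/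
theorem add_mul_le_energyDensityTT'_of_forall_dvd_groundEnergy_dWaveSourceTorus_ge {U : ℝ} (hU : 0 ≤ U)
    (μ : ℝ) {lo : ℝ} {q L₀ : ℕ} (hq : 0 < q)
    (hlo : ∀ (L : ℕ) [NeZero L], L₀ ≤ L → q ∣ L →
      lo * (L : ℝ) ^ 2 ≤ (dWaveSourceTorus L U μ 0).groundEnergy)
    {n : ℝ} (hn0 : 0 ≤ n) (hn2 : n < 2) :
    lo + μ * n ≤ energyDensityTT' 1 0 U n := by
  have h := le_gcEnergyDensityTT'_of_forall_dvd_groundEnergy_dWaveSourceTorus_ge hU μ hq hlo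
  linarith [gcEnergyDensityTT'_add_mul_le 1 0 hU μ hn0 hn2]

/-- **Along any divergent side sequence**: a floor `lo·L_j² ≤ E₀(A_{L_j}(t',U,μ,0))` for all large `j` gives
the tangent `lo + μn ≤ energyDensityTT' 1 t' U n` at every density. [cite: Ruelle1969, §3.4] -/
theorem add_mul_le_energyDensityTT'_of_eventually_groundEnergy_ge_along (t' : ℝ) {U : ℝ} (hU : 0 ≤ U)
    (μ : ℝ) {Ls : ℕ → ℕ} [hL0 : ∀ j, NeZero (Ls j)] (hLs : Tendsto Ls atTop atTop) {lo : ℝ}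
    (hlo : ∀ᶠ j in atTop, lo * ((Ls j : ℝ)) ^ 2 ≤ (dWaveSourceTorusTT' (Ls j) t' U μ 0).groundEnergy)
    {n : ℝ} (hn0 : 0 ≤ n) (hn2 : n < 2) :
    lo + μ * n ≤ energyDensityTT' 1 t' U n := by
  have h := le_gcEnergyDensityTT'_of_eventually_groundEnergy_ge_along t' hU μ hLs hlo
  linarith [gcEnergyDensityTT'_add_mul_le 1 t' hU μ hn0 hn2]

end Tangent

end Literature.MathematicalPhysics.QuantumLattice

end
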